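import Literature.RingTheory.RegularLocalRing.RankOneEmbedding
import Mathlib.RingTheory.Ideal.AssociatedPrime.Basic
import Mathlib.RingTheory.Ideal.Quotient.Operations
import Mathlib.RingTheory.LocalRing.MaximalIdeal.Basic
import Mathlib.RingTheory.UniqueFactorizationDomain.Basic
import Mathlib.RingTheory.Noetherian.Basic
import Mathlib.LinearAlgebra.Isomorphisms
import HarnessLib

/-!
# From the algebraised module of formal sections to an `𝔪`-primary ideal (SGA 2 XI 3.13 (ii))

Topic `Literature/RingTheory/RegularLocalRing`. The penultimate step of the algebraisation route
to the complete case `hC` of `Grothendieck1968_samuelConjecture_hypersurface` (Grothendieck's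
parafactoriality theorem for hypersurfaces `S/(t)`, `S` complete regular local): the module `L`
of algebraised formal sections is a finite torsion-free `S`-module with `L/tL ≃ D`, `D ⊆ S/(t)`
an ideal which is cyclic at every non-maximal prime of `V(t)` and has no `𝔪`-torsion; since
`S` is factorial one deduces an `𝔪`-primary ideal `Ī ⊆ S/(t)` with `D ≃ Ī`
(`exists_ideal_map_linearEquiv_of_torsionFree`), which `SaturationPrincipal` turns into the
principality of the saturation of `D`. Steps: `L` is cyclic at one such prime, hence isomorphic
to an ideal `I ⊆ S` (`RankOneEmbedding`); dividing out the content, `I ≃ I'` with `I'` in no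
proper principal ideal (`exists_linearEquiv_ideal_forall_prime_not_le`, well-founded induction
on divisibility); `I'` lies in no non-maximal prime containing `t` (a prime factor `p ∈ Q` of a
local generator would contain `I'`); `t` is `S/I'`-regular (an associated prime of `S/I'`
containing `t` is `𝔪`, contradicting the absence of `𝔪`-torsion in `D ≃ I'/tI'`); so
`I'/tI' ≃ Ī := I' (S/(t))` and `𝔪^k ⊆ I' + (t)`.

Everything is proved; no named facts.

## References

* [Grothendieck1968SGA2] A. Grothendieck, SGA 2, Exp. IX §2, Exp. XI Thm. 3.13 (ii)
  (arXiv:math/0511279, pp. 58, 72).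
* [Matsumura1987] H. Matsumura, *Commutative Ring Theory*, Thm. 6.1 (associated primes),
  Thm. 20.1.
-/

noncomputable section

universe u

namespace Literature.RingTheory.RegularLocalRing

open IsLocalRing
open scoped Pointwise

/-! ## Factorial rings: prime factors and content -/

/-- In a factorial ring, a non-zero element of a prime ideal `Q` has a prime factor in `Q`.
[folklore] -/
theorem exists_prime_dvd_mem_of_mem {S : Type u} [CommRing S] [IsDomain S]
    [UniqueFactorizationMonoid S] (Q : Ideal S) [Q.IsPrime] {z : S} (hz0 : z ≠ 0) (hzQ : z ∈ Q) :
    ∃ p : S, Prime p ∧ p ∣ z ∧ p ∈ Q := by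
  classical
  obtain ⟨w, hw⟩ := UniqueFactorizationMonoid.factors_prod hz0
  -- `z = (factors z).prod * w`
  have hprod : (UniqueFactorizationMonoid.factors z).prod ∈ Q := by
    have h1 : (UniqueFactorizationMonoid.factors z).prod * (w : S) ∈ Q := by rw [hw]; exact hzQ
    rcases (inferInstance : Q.IsPrime).mem_or_mem h1 with h | h
    · exact h
    · exact absurd (Q.eq_top_of_isUnit_mem h w.isUnit) (inferInstance : Q.IsPrime).ne_top
  obtain ⟨p, hp, hpQ⟩ :=
    ((inferInstance : Q.IsPrime).multiset_prod_mem_iff_exists_mem _).mp hprod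
  exact ⟨p, UniqueFactorizationMonoid.prime_of_factor p hp,
    UniqueFactorizationMonoid.dvd_of_mem_factors hp, hpQ⟩

/-- **Dividing an ideal by its content.** In a factorial domain every non-zero ideal `I` is
`S`-linearly isomorphic to an ideal `I'` contained in no proper principal ideal `(p)`, `p`
prime (`I = c · I'`). Proof by well-founded induction on divisibility of a fixed non-zero element
of `I`. [folklore] -/
theorem exists_linearEquiv_ideal_forall_prime_not_le {S : Type u} [CommRing S] [IsDomain S]
    [UniqueFactorizationMonoid S] (I : Ideal S) (hI : I ≠ ⊥) :
    ∃ I' : Ideal S, (∀ p : S, Prime p → ¬ I' ≤ Ideal.span {p}) ∧ Nonempty (I ≃ₗ[S] I') := by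
  classical
  -- statement proved by induction on a non-zero `z ∈ I`
  suffices H : ∀ z : S, z ≠ 0 → ∀ I : Ideal S, z ∈ I →
      ∃ I' : Ideal S, (∀ p : S, Prime p → ¬ I' ≤ Ideal.span {p}) ∧ Nonempty (I ≃ₗ[S] I') by
    obtain ⟨z, hzI, hz0⟩ := I.ne_bot_iff.mp hI
    exact H z hz0 I hzI
  intro z
  apply WellFounded.induction wellFounded_dvdNotUnit z
  intro z ih hz0 I hzI
  by_cases hgood : ∀ p : S, Prime p → ¬ I ≤ Ideal.span {p}
  · exact ⟨I, hgood, ⟨LinearEquiv.refl S I⟩⟩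
  push Not at hgood
  obtain ⟨p, hp, hIp⟩ := hgood
  -- `I = p · I₁` with `I₁ = {x | p x ∈ I}`
  set I₁ : Ideal S := Submodule.comap (LinearMap.mulLeft S p) I with hI₁
  have hmemI₁ : ∀ x : S, x ∈ I₁ ↔ p * x ∈ I := fun x => Iff.rfl
  have hp0 : p ≠ 0 := hp.ne_zero
  -- `z = p z₁`, `z₁ ∈ I₁`, `z₁` strictly divides `z`
  obtain ⟨z₁, hz₁⟩ := Ideal.mem_span_singleton'.mp (hIp hzI)
  -- hz₁ : z₁ * p = z
  have hz₁I₁ : z₁ ∈ I₁ := by rw [hmemI₁, mul_comm, hz₁]; exact hzI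
  have hz₁0 : z₁ ≠ 0 := fun h => hz0 (by rw [← hz₁, h, zero_mul])
  have hlt : DvdNotUnit z₁ z := ⟨hz₁0, p, hp.not_unit, by rw [← hz₁]⟩
  obtain ⟨I', hI', ⟨e₁⟩⟩ := ih z₁ hlt hz₁0 I₁ hz₁I₁
  -- `I₁ ≃ I` by multiplication by `p`
  have hsurj : ∀ y ∈ I, ∃ x ∈ I₁, p * x = y := fun y hy => by
    obtain ⟨x, hx⟩ := Ideal.mem_span_singleton'.mp (hIp hy)
    exact ⟨x, by rw [hmemI₁, mul_comm, hx]; exact hy, by rw [mul_comm, hx]⟩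
  let f : I₁ →ₗ[S] I :=
    { toFun := fun x => ⟨p * x, (hmemI₁ x).mp x.2⟩
      map_add' := fun x y => Subtype.ext (by simp [mul_add])
      map_smul' := fun c x => Subtype.ext (by simp [mul_left_comm]) }
  have hf_inj : Function.Injective f := fun x y hxy => by
    apply Subtype.ext
    have := congrArg Subtype.val hxy
    exact mul_left_cancel₀ hp0 this
  have hf_surj : Function.Surjective f := fun y => by
    obtain ⟨x, hx, hxy⟩ := hsurj y y.2
    exact ⟨⟨x, hx⟩, Subtype.ext hxy⟩
  exact ⟨I', hI', ⟨(LinearEquiv.ofBijective f ⟨hf_inj, hf_surj⟩).symm.trans e₁⟩⟩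

/-! ## Cyclicity at the primes of `V(t)` off the closed point -/

section Main

variable {S : Type u} [CommRing S] {t : S} {L : Type u} [AddCommGroup L] [Module S L]
  [Module.Finite S L] (D : Ideal (S ⧸ Ideal.span {t}))

/-- **The module of sections is cyclic at every non-maximal prime of `V(t)`.** If `L/tL ≃ D`
with `D ⊆ S/(t)` cyclic at the prime `Q ∋ t` (elementwise: `u d' ∈ S d` with `u ∉ Q`), then
`L` is cyclic at `Q`: some `ℓ ∈ L` satisfies `u x ∈ S ℓ`, `u ∉ Q`, for every `x ∈ L`
(Nakayama at `Q`). [cite: Matsumura1987, Thm. 2.2] -/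
theorem exists_forall_smul_eq_smul_of_quotient (e₁ : (L ⧸ (t • ⊤ : Submodule S L)) ≃ₗ[S] D)
    (Q : Ideal S) [Q.IsPrime] (htQ : t ∈ Q)
    (hcyc : ∃ d ∈ D, ∀ d' ∈ D, ∃ u ∉ Q, ∃ a : S, u • d' = a • d) :
    ∃ ℓ : L, (∃ (d : S ⧸ Ideal.span {t}) (hd : d ∈ D), (∀ d' ∈ D, ∃ u ∉ Q, ∃ a : S,
      u • d' = a • d) ∧ e₁ (Submodule.Quotient.mk ℓ) = ⟨d, hd⟩) ∧
      ∀ x : L, ∃ u ∉ Q, ∃ a : S, u • x = a • ℓ := by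
  obtain ⟨d, hdD, hd⟩ := hcyc
  obtain ⟨ℓ, hℓ⟩ := Submodule.Quotient.mk_surjective _ (e₁.symm ⟨d, hdD⟩)
  have heℓ : e₁ (Submodule.Quotient.mk ℓ) = ⟨d, hdD⟩ := by rw [hℓ, LinearEquiv.apply_symm_apply]
  refine ⟨ℓ, ⟨d, hdD, hd, heℓ⟩, exists_smul_eq_smul_of_forall_add Q htQ ℓ fun x => ?_⟩
  obtain ⟨u, hu, a, hua⟩ := hd (e₁ (Submodule.Quotient.mk x)) (e₁ (Submodule.Quotient.mk x)).2
  -- `u • [x] = a • [ℓ]` in `L/tL`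
  have h1 : (u • e₁ (Submodule.Quotient.mk x) : D) = a • (⟨d, hdD⟩ : D) := Subtype.ext hua
  have h2 : u • Submodule.Quotient.mk (p := (t • ⊤ : Submodule S L)) x =
      a • Submodule.Quotient.mk (p := (t • ⊤ : Submodule S L)) ℓ := by
    apply e₁.injective
    rw [map_smul, map_smul, h1, heℓ]
  have h3 : u • x - a • ℓ ∈ (t • ⊤ : Submodule S L) := by
    rw [← Submodule.Quotient.mk_eq_zero, Submodule.Quotient.mk_sub, Submodule.Quotient.mk_smul,
      Submodule.Quotient.mk_smul, h2, sub_self]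
  obtain ⟨w, -, hw⟩ := (Submodule.mem_smul_pointwise_iff_exists _ _ _).mp h3
  exact ⟨u, hu, a, w, by rw [hw]; abel⟩

/-- **From the algebraised module of formal sections to an `𝔪`-primary ideal.** Let `S` be a
factorial Noetherian local domain, `0 ≠ t ∈ 𝔪`, `L` a finite torsion-free `S`-module with
`L/tL ≃ D` for an ideal `0 ≠ D ⊆ S/(t)` that is cyclic at every non-maximal prime `Q ∋ t` of
`S` (and there is such a prime) and has no non-zero element killed by `𝔪`. Then `D` is
`S/(t)`-linearly isomorphic to an ideal `Ī ⊆ S/(t)` containing the image of a power of `𝔪`.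
[cite: Grothendieck1968SGA2, Exp. XI Thm. 3.13 (ii) (with Exp. IX §2)] -/
theorem exists_ideal_map_linearEquiv_of_torsionFree [IsDomain S] [IsNoetherianRing S]
    [IsLocalRing S] [UniqueFactorizationMonoid S] [NoZeroSMulDivisors S L]
    (e₁ : (L ⧸ (t • ⊤ : Submodule S L)) ≃ₗ[S] D) (ht : t ∈ maximalIdeal S) (ht0 : t ≠ 0)
    (hD0 : D ≠ ⊥)
    (hcyc : ∀ (Q : Ideal S) [Q.IsPrime], t ∈ Q → Q ≠ maximalIdeal S →
      ∃ d ∈ D, ∀ d' ∈ D, ∃ u ∉ Q, ∃ a : S, u • d' = a • d)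
    (hQ₀ : ∃ Q : Ideal S, Q.IsPrime ∧ t ∈ Q ∧ Q ≠ maximalIdeal S)
    (hDtf : ∀ d ∈ D, (∀ x ∈ maximalIdeal S, x • d = 0) → d = 0) :
    ∃ I : Ideal (S ⧸ Ideal.span {t}),
      (∃ k : ℕ, (maximalIdeal S ^ k).map (Ideal.Quotient.mk (Ideal.span {t})) ≤ I) ∧
      Nonempty (D ≃ₗ[S ⧸ Ideal.span {t}] I) := by
  classical
  set π := Ideal.Quotient.mk (Ideal.span {t}) with hπ
  -- Step A: `L` is cyclic at `Q₀`, hence isomorphic to an ideal `I` of `S`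
  obtain ⟨Q₀, hQ₀p, htQ₀, hQ₀m⟩ := hQ₀
  haveI := hQ₀p
  obtain ⟨ℓ₀, -, hℓ₀⟩ := exists_forall_smul_eq_smul_of_quotient D e₁ Q₀ htQ₀ (hcyc Q₀ htQ₀ hQ₀m)
  have hL0 : Nontrivial L := by
    by_contra hL
    haveI : Subsingleton L := not_nontrivial_iff_subsingleton.mp hL
    apply hD0
    rw [eq_bot_iff]
    intro d hd
    have h1 : (⟨d, hd⟩ : D) = 0 := by
      have : e₁.symm ⟨d, hd⟩ = 0 := Subsingleton.elim _ _
      simpa using congrArg e₁ this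
    simpa using congrArg Subtype.val h1
  have hℓ₀0 : ℓ₀ ≠ 0 := by
    intro h0
    obtain ⟨x, hx⟩ := exists_ne (0 : L)
    obtain ⟨u, hu, a, hua⟩ := hℓ₀ x
    rw [h0, smul_zero] at hua
    have hu0 : u ≠ 0 := fun h => hu (h ▸ Q₀.zero_mem)
    exact hx ((smul_eq_zero.mp hua).resolve_left hu0)
  obtain ⟨I, ⟨e₂⟩⟩ := exists_ideal_linearEquiv_of_forall_smul_eq_smul Q₀ hℓ₀0 hℓ₀
  -- Step B: divide out the content: `L ≃ I'` with `I'` in no proper principal prime ideal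
  have hI0 : I ≠ ⊥ := by
    intro hI
    have h0 : (e₂ ℓ₀ : S) = 0 := (Submodule.eq_bot_iff I).mp hI _ (e₂ ℓ₀).2
    have h1 : e₂ ℓ₀ = 0 := Subtype.ext h0
    exact hℓ₀0 (e₂.injective (by rw [h1, map_zero]))
  obtain ⟨I', hI'c, ⟨e₃⟩⟩ := exists_linearEquiv_ideal_forall_prime_not_le I hI0
  set e : L ≃ₗ[S] I' := e₂.trans e₃ with he
  -- Step C: `I'` is cyclic at every non-maximal prime `Q ∋ t`, hence not contained in it
  have hI'Q : ∀ (Q : Ideal S) [Q.IsPrime], t ∈ Q → Q ≠ maximalIdeal S → ¬ I' ≤ Q := by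
    intro Q _ htQ hQm hI'Q
    obtain ⟨ℓ, -, hℓ⟩ := exists_forall_smul_eq_smul_of_quotient D e₁ Q htQ (hcyc Q htQ hQm)
    set z : S := (e ℓ : S) with hz
    have hzI' : z ∈ I' := (e ℓ).2
    have hcycI' : ∀ x' ∈ I', ∃ u ∉ Q, ∃ a : S, u * x' = a * z := by
      intro x' hx'
      obtain ⟨u, hu, a, hua⟩ := hℓ (e.symm ⟨x', hx'⟩)
      refine ⟨u, hu, a, ?_⟩
      have h := congrArg (fun y : I' => (y : S)) (congrArg e hua)
      simpa [map_smul] using h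
    have hz0 : z ≠ 0 := by
      intro hz0
      -- then `I' = 0`, contradicting `L ≠ 0`
      obtain ⟨x, hx⟩ := exists_ne (0 : L)
      obtain ⟨u, hu, a, hua⟩ := hcycI' (e x) (e x).2
      rw [hz0, mul_zero] at hua
      have hu0 : u ≠ 0 := fun h => hu (h ▸ Q.zero_mem)
      have : (e x : S) = 0 := (mul_eq_zero.mp hua).resolve_left hu0
      exact hx (e.injective (Subtype.ext (by simpa using this)))
    obtain ⟨p, hp, hpz, hpQ⟩ := exists_prime_dvd_mem_of_mem Q hz0 (hI'Q hzI')
    refine hI'c p hp fun x' hx' => ?_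
    obtain ⟨u, hu, a, hua⟩ := hcycI' x' hx'
    have h1 : p ∣ u * x' := by rw [hua]; exact dvd_mul_of_dvd_right hpz a
    rcases hp.dvd_or_dvd h1 with h | h
    · exact absurd ((Ideal.span_singleton_le_iff_mem Q).mpr hpQ (Ideal.mem_span_singleton.mpr h)) hu
    · exact Ideal.mem_span_singleton.mpr h
  -- the equivalence `I'/tI' ≃ D`
  have hmap : Submodule.map (e : L →ₗ[S] I') (t • ⊤ : Submodule S L) = (t • ⊤ : Submodule S I') := by
    rw [Submodule.map_pointwise_smul, Submodule.map_top, LinearEquiv.range]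
  set eD : (I' ⧸ (t • ⊤ : Submodule S I')) ≃ₗ[S] D :=
    (Submodule.Quotient.equiv (t • ⊤) (t • ⊤) e hmap).symm.trans e₁ with heD
  -- Step D: `t` is `S/I'`-regular
  have hreg : ∀ x : S, t * x ∈ I' → x ∈ I' := by
    intro x htx
    by_contra hxI
    have hx0 : (Ideal.Quotient.mk I' x) ≠ 0 := fun h => hxI (Ideal.Quotient.eq_zero_iff_mem.mp h)
    obtain ⟨P, hP, hPx⟩ :=
      exists_le_isAssociatedPrime_of_isNoetherianRing S (Ideal.Quotient.mk I' x) hx0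
    obtain ⟨hPprime, x', hPx'⟩ := isAssociatedPrime_iff.mp hP
    haveI := hPprime
    have htP : t ∈ P := by
      refine hPx (Submodule.mem_colon_singleton.mpr ?_)
      rw [Algebra.smul_def, Ideal.Quotient.algebraMap_eq, ← map_mul, Submodule.mem_bot,
        Ideal.Quotient.eq_zero_iff_mem]
      exact htx
    obtain ⟨b, rfl⟩ := Ideal.Quotient.mk_surjective x'
    have hmemP : ∀ r : S, r ∈ P ↔ r * b ∈ I' := fun r => by
      rw [hPx', Submodule.mem_colon_singleton, Algebra.smul_def, Ideal.Quotient.algebraMap_eq,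
        ← map_mul, Submodule.mem_bot, Ideal.Quotient.eq_zero_iff_mem]
    have hI'P : I' ≤ P := fun i hi => (hmemP i).mpr (I'.mul_mem_right b hi)
    by_cases hPm : P = maximalIdeal S
    · -- `𝔪 b ⊆ I'`, `b ∉ I'`: transport the class of `t b` to `D`
      have hbI : b ∉ I' := by
        intro hb
        apply hPprime.ne_top
        rw [eq_top_iff]
        intro r _
        exact (hmemP r).mpr (I'.mul_mem_left r hb)
      have hmb : ∀ r ∈ maximalIdeal S, r * b ∈ I' := fun r hr => (hmemP r).mp (hPm ▸ hr)
      set yv : I' := ⟨t * b, hmb t ht⟩ with hyv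
      have hy0 : Submodule.Quotient.mk (p := (t • ⊤ : Submodule S I')) yv ≠ 0 := by
        intro h0
        rw [Submodule.Quotient.mk_eq_zero] at h0
        obtain ⟨w, -, hw⟩ := (Submodule.mem_smul_pointwise_iff_exists _ _ _).mp h0
        have h1 : t * (w : S) = t * b := congrArg Subtype.val hw
        have h2 : (w : S) = b := mul_left_cancel₀ ht0 h1
        exact hbI (h2 ▸ w.2)
      have hym : ∀ r ∈ maximalIdeal S,
          r • Submodule.Quotient.mk (p := (t • ⊤ : Submodule S I')) yv = 0 := by
        intro r hr
        rw [← Submodule.Quotient.mk_smul, Submodule.Quotient.mk_eq_zero]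
        refine (Submodule.mem_smul_pointwise_iff_exists _ _ _).mpr
          ⟨⟨r * b, hmb r hr⟩, Submodule.mem_top, Subtype.ext ?_⟩
        change t * (r * b) = r * (t * b)
        ring
      set d : D := eD (Submodule.Quotient.mk yv) with hd
      have hd0 : (d : S ⧸ Ideal.span {t}) ≠ 0 := by
        intro h0
        have h1 : d = 0 := Subtype.ext h0
        exact hy0 (eD.injective (by rw [← hd, h1, map_zero]))
      refine hd0 (hDtf d d.2 fun r hr => ?_)
      have h1 : r • d = 0 := by rw [hd, ← map_smul, hym r hr, map_zero]
      have h2 := congrArg Subtype.val h1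
      simpa using h2
    · exact hI'Q P htP hPm hI'P
  -- Step E: the `𝔪`-primary ideal `Ī = I' (S/(t))` and `I'/tI' ≃ Ī`
  set Ibar : Ideal (S ⧸ Ideal.span {t}) := I'.map π with hIbar
  have hprim : ∃ k : ℕ, (maximalIdeal S ^ k).map π ≤ Ibar := by
    have hrad : maximalIdeal S ≤ (I' ⊔ Ideal.span {t}).radical := by
      rw [Ideal.radical_eq_sInf]
      refine le_sInf fun Q hQ => ?_
      obtain ⟨hQle, hQprime⟩ := hQ
      haveI := hQprime
      by_contra hmQ
      have hQm : Q ≠ maximalIdeal S := fun h => hmQ (h ▸ le_rfl)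
      exact hI'Q Q ((Ideal.span_singleton_le_iff_mem Q).mp (le_sup_right.trans hQle)) hQm
        (le_sup_left.trans hQle)
    obtain ⟨k, hk⟩ := Ideal.exists_pow_le_of_le_radical_of_fg hrad (IsNoetherian.noetherian _)
    refine ⟨k, (Ideal.map_mono hk).trans ?_⟩
    rw [Ideal.map_sup, hπ, Ideal.map_quotient_self, sup_bot_eq]
  let ψ : I' →ₗ[S] Ibar :=
    { toFun := fun x => ⟨π x, Ideal.mem_map_of_mem π x.2⟩
      map_add' := fun x x' => Subtype.ext (by simp)
      map_smul' := fun c x => Subtype.ext (by simp [Algebra.smul_def, hπ]) }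
  have hψsurj : Function.Surjective ψ := fun z => by
    obtain ⟨x, hx, hxz⟩ :=
      (Ideal.mem_map_iff_of_surjective π Ideal.Quotient.mk_surjective).mp z.2
    exact ⟨⟨x, hx⟩, Subtype.ext hxz⟩
  have hψker : LinearMap.ker ψ = (t • ⊤ : Submodule S I') := by
    ext x
    constructor
    · intro hx
      have h1 : (x : S) ∈ Ideal.span {t} :=
        Ideal.Quotient.eq_zero_iff_mem.mp (congrArg Subtype.val (LinearMap.mem_ker.mp hx))
      obtain ⟨sx, hsx⟩ := Ideal.mem_span_singleton'.mp h1
      have hsI : sx ∈ I' := hreg sx (by rw [mul_comm, hsx]; exact x.2)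
      exact (Submodule.mem_smul_pointwise_iff_exists _ _ _).mpr
        ⟨⟨sx, hsI⟩, Submodule.mem_top, Subtype.ext (by change t * sx = x; rw [mul_comm, hsx])⟩
    · intro hx
      obtain ⟨w, -, rfl⟩ := (Submodule.mem_smul_pointwise_iff_exists _ _ _).mp hx
      rw [LinearMap.mem_ker]
      apply Subtype.ext
      change π (t * w) = 0
      rw [map_mul, hπ, Ideal.Quotient.eq_zero_iff_mem.mpr (Ideal.mem_span_singleton_self t),
        zero_mul]
  let ε : (I' ⧸ (t • ⊤ : Submodule S I')) ≃ₗ[S] Ibar :=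
    (Submodule.quotEquivOfEq _ _ hψker.symm).trans (LinearMap.quotKerEquivOfSurjective ψ hψsurj)
  let εD : D ≃ₗ[S] Ibar := eD.symm.trans ε
  exact ⟨Ibar, hprim, ⟨εD.extendScalarsOfSurjective Ideal.Quotient.mk_surjective⟩⟩

end Main

end Literature.RingTheory.RegularLocalRing

end
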